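import Summits.CriticalPhenomena.PercolationContinuityZ3.Theorems.PercNearOneGluingNoHeavyLowerTailSahiCombTriWAndRectangle

/-!
# AND-products: a rectangle against a rectangle, with ARBITRARY sides — `Cor_{P₁ ∧ Q}(A₁ × A₂, B₁ × B₂) ≥ 0`

Support file of the one-cut programme (crux `NoHeavyLowerTail`, stmt-CriticalPhenomena-4575; unit `prim-lf-1` gen 60, memo
`FROM-prim-lf-1-gen60-ONE-BLOCK.md` §2c).  Third unconditional stratum of (II)/`AndShellLower` after `…TriWAndOneBlock` (one-block tests against
anything) and `…TriWAndRectangle` (rectangles with GOOD sides against anything): here BOTH test sets are rectangles `andProd A₁ A₂`, `andProd B₁ B₂`,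
and in exchange their sides `A₁, B₁ ⊆ 2^{γ₁}`, `A₂, B₂ ⊆ 2^{γ₂}` are ARBITRARY up-sets.

* `andProd_inter_andProd`, `card_andProd` — rectangles intersect blockwise and `#(X₁ × X₂) = #X₁ · #X₂`;
* **`corP_andProd_rect_rect_eq`** — the 2×2-TABLE FORMULA
  `Cor_{P₁∧Q}(A₁×A₂, B₁×B₂) = α α' + δ δ' − β β' − γ γ'`, where `(α, β, γ, δ) = (#(P₁∩A₁∩B₁), #(P₁∩A₁∩refl B₁), #(P₁∩refl A₁∩B₁), #(P₁∩refl A₁∩refl B₁))`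
  is the antipodal 2×2 table of `(A₁, B₁)` on `P₁` and `(α', β', γ', δ')` that of `(A₂, B₂)` on `Q`;
* **`table_ineq`** — the arithmetic heart: if `β, γ ≤ α`, `0 ≤ γ, δ`, `β + γ ≤ α + δ` and `β', γ' ≤ α'`, `0 ≤ β', δ'`, `β'+γ' ≤ α'+δ'`, then `β β' + γ γ' ≤ α α' + δ δ'`
  (write `αα'+δδ'−ββ'−γγ' = δδ' + (α−β)(α'−γ') + (α−γ)(α'−β') − (α−β−γ)(α'−β'−γ')` and split on the signs of `α−β−γ`, `α'−β'−γ'`: when both are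
  `≤ 0` the last product is at most `δδ'` by the GOODNESS inequalities `β+γ−α ≤ δ`, when both are `≥ 0` it is at most `(α−β)(α'−γ')`);
* **`corP_andProd_rect_rect_nonneg`** — THEOREM: if `P₁` and `Q` are up-sets with `Cor ≥ 0` on all pairs of up-sets (Kleitman shells in the `Cor` sense;
  NOT required to be antipode free) and `A₁, B₁, A₂, B₂` are ANY up-sets, then `0 ≤ corP (andProd P₁ Q) (andProd A₁ A₂) (andProd B₁ B₂)`:
  the hypotheses of `table_ineq` are two Kleitman inequalities inside the up-sets `P₁ ∩ A₁`, `P₁ ∩ B₁` (`card_refl_inter_le`) and `Cor_{P₁}(A₁,B₁) ≥ 0`,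
  and the same on `Q`;  `…_of_klShell` takes antipode-free shells.
So among two-block tests, rectangle-versus-rectangle is settled in full generality; what remains open in (II) are pairs with at least one
NON-rectangular two-block member (e.g. the OR of two one-block sets, straddling thresholds `maj3(x₁,x₂,y₁)`).
HONEST LABEL: complete proofs, std axioms; elementary (cardinal arithmetic + one case split). [this work]
-/

namespace Summit.CriticalPhenomena.PercolationContinuityZ3.Theorems

namespace FiveUpSet

open Finset

variable {γ₁ γ₂ : Type} [DecidableEq γ₁] [Fintype γ₁] [DecidableEq γ₂] [Fintype γ₂]

/-! ### Rectangles: intersections and cardinality -/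

/-- Rectangles intersect blockwise. [this work] -/
theorem andProd_inter_andProd (X₁ Y₁ : Finset (Finset γ₁)) (X₂ Y₂ : Finset (Finset γ₂)) :
    andProd X₁ X₂ ∩ andProd Y₁ Y₂ = andProd (X₁ ∩ Y₁) (X₂ ∩ Y₂) := by
  ext t
  simp only [mem_inter, mem_andProd]
  tauto

/-- `#(X₁ × X₂) = #X₁ · #X₂`. [this work] -/
theorem card_andProd (X₁ : Finset (Finset γ₁)) (X₂ : Finset (Finset γ₂)) : (andProd X₁ X₂).card = X₁.card * X₂.card := by
  rw [andProd_eq_biUnion, card_biUnion (pairwiseDisjoint_rows X₁ X₂)]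
  simp only [card_map, sum_const, smul_eq_mul]

/-- **The 2×2-table formula**: `Cor_{P₁∧Q}(A₁×A₂, B₁×B₂) = αα' + δδ' − ββ' − γγ'`. [this work] -/
theorem corP_andProd_rect_rect_eq (P₁ A₁ B₁ : Finset (Finset γ₁)) (Q A₂ B₂ : Finset (Finset γ₂)) :
    corP (andProd P₁ Q) (andProd A₁ A₂) (andProd B₁ B₂)
      = ((P₁ ∩ A₁ ∩ B₁).card : ℤ) * (Q ∩ A₂ ∩ B₂).card + ((P₁ ∩ refl A₁ ∩ refl B₁).card : ℤ) * (Q ∩ refl A₂ ∩ refl B₂).card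
        - ((P₁ ∩ A₁ ∩ refl B₁).card : ℤ) * (Q ∩ A₂ ∩ refl B₂).card - ((P₁ ∩ refl A₁ ∩ B₁).card : ℤ) * (Q ∩ refl A₂ ∩ B₂).card := by
  unfold corP
  rw [refl_andProd, refl_andProd]
  simp only [andProd_inter_andProd, card_andProd]
  push_cast
  ring

/-! ### The arithmetic heart -/

/-- **The table inequality.**  For two "antipodal 2×2 tables" `(α,β,γ,δ)`, `(α',β',γ',δ')` with `β, γ ≤ α`, `0 ≤ γ, δ`, `β + γ ≤ α + δ` and
`β', γ' ≤ α'`, `0 ≤ β', δ'`, `β' + γ' ≤ α' + δ'`:  `ββ' + γγ' ≤ αα' + δδ'` (only one sign hypothesis per table is needed). [this work] -/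
theorem table_ineq {α β γ δ α' β' γ' δ' : ℤ} (hγ : 0 ≤ γ) (hδ : 0 ≤ δ) (hβα : β ≤ α) (hγα : γ ≤ α) (hs : β + γ ≤ α + δ)
    (hβ' : 0 ≤ β') (hδ' : 0 ≤ δ') (hβα' : β' ≤ α') (hγα' : γ' ≤ α') (hs' : β' + γ' ≤ α' + δ') :
    β * β' + γ * γ' ≤ α * α' + δ * δ' := by
  have key : α * α' + δ * δ' - β * β' - γ * γ'
      = δ * δ' + (α - β) * (α' - γ') + (α - γ) * (α' - β') - (α - β - γ) * (α' - β' - γ') := by ring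
  have p1 : 0 ≤ (α - β) * (α' - γ') := mul_nonneg (by linarith) (by linarith)
  have p2 : 0 ≤ (α - γ) * (α' - β') := mul_nonneg (by linarith) (by linarith)
  have p3 : 0 ≤ δ * δ' := mul_nonneg hδ hδ'
  rcases le_or_gt 0 (α - β - γ) with hm | hm <;> rcases le_or_gt 0 (α' - β' - γ') with hm' | hm'
  · -- both non-negative: the product is at most `(α−β)(α'−γ')`
    have h : (α - β - γ) * (α' - β' - γ') ≤ (α - β) * (α' - γ') :=
      mul_le_mul (by linarith) (by linarith) hm' (by linarith)
    linarith
  · have h : (α - β - γ) * (α' - β' - γ') ≤ 0 := mul_nonpos_of_nonneg_of_nonpos hm hm'.le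
    linarith
  · have h : (α - β - γ) * (α' - β' - γ') ≤ 0 := mul_nonpos_of_nonpos_of_nonneg hm.le hm'
    linarith
  · -- both negative: the product is `(β+γ−α)(β'+γ'−α') ≤ δδ'` by the goodness inequalities
    have h : (α - β - γ) * (α' - β' - γ') ≤ δ * δ' := by
      have e : (α - β - γ) * (α' - β' - γ') = (β + γ - α) * (β' + γ' - α') := by ring
      rw [e]
      exact mul_le_mul (by linarith) (by linarith) (by linarith) hδ
    linarith

/-! ### The theorem -/

/-- Kleitman inside an up-set: `#(U ∩ A ∩ refl B) ≤ #(U ∩ A ∩ B)` for up-sets `U, A, B`. [this work] -/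
theorem card_inter_inter_refl_le {U A B : Finset (Finset γ₁)} (hU : IsUpperSet (U : Set (Finset γ₁))) (hA : IsUpperSet (A : Set (Finset γ₁)))
    (hB : IsUpperSet (B : Set (Finset γ₁))) : (U ∩ A ∩ refl B).card ≤ (U ∩ A ∩ B).card := by
  have hUA : IsUpperSet ((U ∩ A : Finset (Finset γ₁)) : Set (Finset γ₁)) := by rw [coe_inter]; exact hU.inter hA
  have h := card_refl_inter_le hUA hB
  rwa [inter_comm (refl B), inter_comm B] at h

/-- Kleitman inside an up-set, antipode on the first test set: `#(U ∩ refl A ∩ B) ≤ #(U ∩ A ∩ B)`. [this work] -/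
theorem card_inter_refl_inter_le {U A B : Finset (Finset γ₁)} (hU : IsUpperSet (U : Set (Finset γ₁))) (hA : IsUpperSet (A : Set (Finset γ₁)))
    (hB : IsUpperSet (B : Set (Finset γ₁))) : (U ∩ refl A ∩ B).card ≤ (U ∩ A ∩ B).card := by
  have h := card_inter_inter_refl_le hU hB hA
  rwa [inter_right_comm U B, inter_right_comm U B A] at h

/-- **THEOREM (rectangle against rectangle, arbitrary sides).**  Let `P₁ ⊆ 2^{γ₁}` and `Q ⊆ 2^{γ₂}` be up-sets with `Cor ≥ 0` on all pairs of up-sets,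
and `A₁, B₁ ⊆ 2^{γ₁}`, `A₂, B₂ ⊆ 2^{γ₂}` ANY up-sets.  Then `Cor_{P₁ ∧ Q}(A₁ × A₂, B₁ × B₂) ≥ 0`. [this work] -/
theorem corP_andProd_rect_rect_nonneg {P₁ : Finset (Finset γ₁)} (hP : IsUpperSet (P₁ : Set (Finset γ₁)))
    (hcor : ∀ U V : Finset (Finset γ₁), IsUpperSet (U : Set (Finset γ₁)) → IsUpperSet (V : Set (Finset γ₁)) → 0 ≤ corP P₁ U V)
    {Q : Finset (Finset γ₂)} (hQ : IsUpperSet (Q : Set (Finset γ₂)))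
    (hcorQ : ∀ U V : Finset (Finset γ₂), IsUpperSet (U : Set (Finset γ₂)) → IsUpperSet (V : Set (Finset γ₂)) → 0 ≤ corP Q U V)
    {A₁ B₁ : Finset (Finset γ₁)} (hA₁ : IsUpperSet (A₁ : Set (Finset γ₁))) (hB₁ : IsUpperSet (B₁ : Set (Finset γ₁)))
    {A₂ B₂ : Finset (Finset γ₂)} (hA₂ : IsUpperSet (A₂ : Set (Finset γ₂))) (hB₂ : IsUpperSet (B₂ : Set (Finset γ₂))) :
    0 ≤ corP (andProd P₁ Q) (andProd A₁ A₂) (andProd B₁ B₂) := by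
  rw [corP_andProd_rect_rect_eq]
  have h1 := hcor A₁ B₁ hA₁ hB₁
  have h2 := hcorQ A₂ B₂ hA₂ hB₂
  unfold corP at h1 h2
  have k1 := card_inter_inter_refl_le hP hA₁ hB₁
  have k2 := card_inter_refl_inter_le hP hA₁ hB₁
  have k1' := card_inter_inter_refl_le hQ hA₂ hB₂
  have k2' := card_inter_refl_inter_le hQ hA₂ hB₂
  have t := table_ineq (α := ((P₁ ∩ A₁ ∩ B₁).card : ℤ)) (β := ((P₁ ∩ A₁ ∩ refl B₁).card : ℤ)) (γ := ((P₁ ∩ refl A₁ ∩ B₁).card : ℤ))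
    (δ := ((P₁ ∩ refl A₁ ∩ refl B₁).card : ℤ)) (α' := ((Q ∩ A₂ ∩ B₂).card : ℤ)) (β' := ((Q ∩ A₂ ∩ refl B₂).card : ℤ))
    (γ' := ((Q ∩ refl A₂ ∩ B₂).card : ℤ)) (δ' := ((Q ∩ refl A₂ ∩ refl B₂).card : ℤ))
    (by positivity) (by positivity) (by exact_mod_cast k1) (by exact_mod_cast k2) (by linarith)
    (by positivity) (by positivity) (by exact_mod_cast k1') (by exact_mod_cast k2') (by linarith)
  linarith

/-- The same with antipode-free Kleitman-shell hypotheses on the two factors. [this work] -/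
theorem corP_andProd_rect_rect_nonneg_of_klShell {P₁ : Finset (Finset γ₁)} (hP : IsUpperSet (P₁ : Set (Finset γ₁))) (hd : Disjoint P₁ (refl P₁))
    (hs : KlShell (P₁ ∪ refl P₁))
    {Q : Finset (Finset γ₂)} (hQ : IsUpperSet (Q : Set (Finset γ₂))) (hdQ : Disjoint Q (refl Q)) (hsQ : KlShell (Q ∪ refl Q))
    {A₁ B₁ : Finset (Finset γ₁)} (hA₁ : IsUpperSet (A₁ : Set (Finset γ₁))) (hB₁ : IsUpperSet (B₁ : Set (Finset γ₁)))
    {A₂ B₂ : Finset (Finset γ₂)} (hA₂ : IsUpperSet (A₂ : Set (Finset γ₂))) (hB₂ : IsUpperSet (B₂ : Set (Finset γ₂))) :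
    0 ≤ corP (andProd P₁ Q) (andProd A₁ A₂) (andProd B₁ B₂) :=
  corP_andProd_rect_rect_nonneg hP (fun U V hU hV => by rw [corP_eq_card_sub_card_of_disjoint hd]; exact hs U V hU hV) hQ
    (fun U V hU hV => by rw [corP_eq_card_sub_card_of_disjoint hdQ]; exact hsQ U V hU hV) hA₁ hB₁ hA₂ hB₂

/-- **The cube as a factor**: on a cylinder `2^{γ₁} × Q` over a shell `Q`, rectangle-versus-rectangle tests pass (Kleitman supplies `Cor_univ ≥ 0`). [this work] -/
theorem corP_andProd_univ_rect_rect_nonneg {Q : Finset (Finset γ₂)} (hQ : IsUpperSet (Q : Set (Finset γ₂)))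
    (hcorQ : ∀ U V : Finset (Finset γ₂), IsUpperSet (U : Set (Finset γ₂)) → IsUpperSet (V : Set (Finset γ₂)) → 0 ≤ corP Q U V)
    {A₁ B₁ : Finset (Finset γ₁)} (hA₁ : IsUpperSet (A₁ : Set (Finset γ₁))) (hB₁ : IsUpperSet (B₁ : Set (Finset γ₁)))
    {A₂ B₂ : Finset (Finset γ₂)} (hA₂ : IsUpperSet (A₂ : Set (Finset γ₂))) (hB₂ : IsUpperSet (B₂ : Set (Finset γ₂))) :
    0 ≤ corP (andProd (univ : Finset (Finset γ₁)) Q) (andProd A₁ A₂) (andProd B₁ B₂) :=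
  corP_andProd_rect_rect_nonneg (by rw [coe_univ]; exact isUpperSet_univ) (fun U V hU hV => corP_univ_nonneg hU hV) hQ hcorQ hA₁ hB₁ hA₂ hB₂

end FiveUpSet

end Summit.CriticalPhenomena.PercolationContinuityZ3.Theorems
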